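import Literature.Topology.FourManifolds.ClosedBallSmoothMaps
import Literature.Topology.FourManifolds.TwistedSpheres
import HarnessLib

/-!
# Charts of a gluing of two discs adapted to the seam

Trunk T-4MAN (`Literature/Topology/FourManifolds`). Second of the files discharging, for two
closed discs, the tree's named fact `Literature.Topology.FourManifolds.nonempty_diffeomorph_of_isBoundaryGluing` (`Gluing.lean`;
Hirsch (1976), Ch. 8, Thm. 2.1: the gluing `M ∪_φ N` is well defined up to diffeomorphism), after
`CollarUniquenessBall.lean`. Here we set up the local theory of a gluing
`P = 𝔻ⁿ⁺¹ ∪_φ 𝔻ⁿ⁺¹` (`Literature.IsTwistedSphere n φ P`, `TwistedSpheres.lean`) near its *seam*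
`jA (𝕊ⁿ) = jB (𝕊ⁿ)`:

* `Literature.BallGluingData n φ P`: the data `(jA, jB)` of the two smooth embeddings of the closed
  disc realising `P` as `𝔻ⁿ⁺¹ ∪_φ 𝔻ⁿ⁺¹` (a choice of witnesses of `IsTwistedSphere n φ P`).
* Boundary invariance for charts of the *maximal* atlas of a `C¹` manifold with boundary
  (`Literature.Topology.FourManifolds.isInteriorPoint_iff_of_mem_maximalAtlas`; Mathlib proves it for charts of the atlas),
  and its reading on `𝔻ⁿ⁺¹`: a maximal-atlas chart sends `x` to the open half space iff
  `‖x‖ < 1` (`Literature.Topology.FourManifolds.norm_lt_one_iff_of_mem_maximalAtlas`).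
* `Manifold.IsImmersionAt.normalChart`: for an immersion `j : 𝔻ⁿ⁺¹ → P` at `x` (equal
  dimensions), the codomain chart of Mathlib's immersion data composed with the inverse of its
  linear part, a chart `c` of `P` with `c (j y) = (domChart y).val`: in it `j` *is* the domain
  chart.
* `Literature.Topology.FourManifolds.contDiffOn_coe_ballEmbeddingInv_symm`: for a smooth embedding `j : 𝔻ⁿ⁺¹ → P` and any chart
  `c` of the maximal atlas of `P`, the map `c.symm ≫ j⁻¹ ≫ (𝔻ⁿ⁺¹ ⊆ ℝⁿ⁺¹)` is `C^∞` on
  `c '' (range j ∩ c.source)` (in the sense of `ContDiffOn`, i.e. with one-sided derivatives at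
  the image of the boundary).
* `Literature.BallGluingData.SeamChart G z` and `Literature.Topology.FourManifolds.BallGluingData.seamChart`: at every point of the
  seam there is a chart `c` of the maximal atlas of `P` whose target is a ball `B(u₀, r)` with
  `u₀ 0 = 0`, in which `range jB` is exactly `{u | 0 ≤ u 0}` and `range jA` is exactly
  `{u | u 0 ≤ 0}` (so the seam is the hyperplane `{u 0 = 0}`).
* Smoothness on `𝔻ⁿ⁺¹` versus smoothness within the closed ball of `ℝⁿ⁺¹`
  (`Literature.contMDiffAt_iff_contDiffWithinAt_comp_closedBallRetraction`).

These are the charts in which `BallGluingSeam.lean` builds a bicollar of the seam by a partition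
of unity, and `BallGluingUniqueness.lean` proves Hirsch's Theorem 8.2.1 for two discs.

## References

* M. W. Hirsch, *Differential Topology*, GTM 33, Springer (1976), Ch. 1 §4 (manifolds with
  boundary, invariance of the boundary), Ch. 8 §2 (gluing).
* J. M. Lee, *Introduction to Smooth Manifolds*, 2nd ed. (2013), Thm. 1.46 (smooth invariance of
  the boundary), Ch. 5 (regular domains).
-/

open scoped Manifold ContDiff Topology
open Set Function Metric

noncomputable section

namespace Literature.Topology.FourManifolds

/-! ### Boundary invariance for charts of the maximal atlas -/

section Invariance

variable {E H M : Type*} [NormedAddCommGroup E] [NormedSpace ℝ E] [TopologicalSpace H]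
  {I : ModelWithCorners ℝ E H} [TopologicalSpace M] [ChartedSpace H M] {m : WithTop ℕ∞}
  {e e' : OpenPartialHomeomorph M H} {x : M}

/-- **Invariance of the interior under change of charts, maximal-atlas version.** If two charts
`e`, `e'` of the maximal `C^m` atlas (`m ≠ 0`) contain `x` in their sources and `e` sends `x` to
an interior point of its (extended) target, then so does `e'`. Mathlib's
`mem_interior_range_of_mem_interior_range_of_mem_atlas` is the same statement for charts of the
atlas; the proof is identical (the transition map is a local diffeomorphism, and a differentiable
map with surjective differential into a closed convex set with nonempty interior lands in the
interior). Lee (2013), Thm. 1.46. [cite: LeeSmoothManifolds2013, Thm. 1.46] -/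
theorem mem_interior_extend_target_of_mem_maximalAtlas (hm : m ≠ 0)
    (he : e ∈ IsManifold.maximalAtlas I m M) (he' : e' ∈ IsManifold.maximalAtlas I m M)
    (hex : x ∈ e.source) (hex' : x ∈ e'.source)
    (hx : e.extend I x ∈ interior (e.extend I).target) :
    e'.extend I x ∈ interior (e'.extend I).target := by
  let φ := I.extendCoordChange e e'
  have hφ : ContDiffOn ℝ m φ φ.source := I.contDiffOn_extendCoordChange he he'
  suffices h : Function.Surjective (fderivWithin ℝ φ φ.source (e.extend I x)) →
      e'.extend I x ∈ interior (range I) by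
    refine e'.mem_interior_extend_target (by simp [hex']) <| h ?_
    exact (I.isInvertible_fderivWithin_extendCoordChange hm he he' <| by simp [hex, hex']).surjective
  intro hφx'
  have hφx : φ.source ∈ 𝓝 (e.extend I x) := by
    simp_rw [φ, ModelWithCorners.extendCoordChange, PartialEquiv.trans_source,
      PartialEquiv.symm_source, Filter.inter_mem_iff, mem_interior_iff_mem_nhds.1 hx, true_and,
      e'.extend_source]
    exact e.extend_preimage_mem_nhds hex <| e'.open_source.mem_nhds hex'
  rw [fderivWithin_of_mem_nhds hφx] at hφx'
  rw [show e'.extend I x = φ (e.extend I x) by simp [φ, hex]]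
  have hd : DifferentiableAt ℝ φ (e.extend I x) := (hφ.differentiableOn hm).differentiableAt hφx
  exact hd.mem_interior_convex_of_surjective_fderiv hφx I.convex_range I.isClosed_range
    I.nonempty_interior (φ.mapsTo.mono_right <| by simp [φ, inter_assoc]) hφx'

/-- Maximal-atlas charts agree on which points are sent to the interior of the model.
[cite: LeeSmoothManifolds2013, Thm. 1.46] -/
theorem mem_interior_extend_target_iff_of_mem_maximalAtlas (hm : m ≠ 0)
    (he : e ∈ IsManifold.maximalAtlas I m M) (he' : e' ∈ IsManifold.maximalAtlas I m M)
    (hex : x ∈ e.source) (hex' : x ∈ e'.source) :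
    e.extend I x ∈ interior (e.extend I).target ↔ e'.extend I x ∈ interior (e'.extend I).target :=
  ⟨mem_interior_extend_target_of_mem_maximalAtlas hm he he' hex hex',
    mem_interior_extend_target_of_mem_maximalAtlas hm he' he hex' hex⟩

/-- **A point is an interior point iff any chart of the maximal atlas sends it to the interior of
the model** (Mathlib's `isInteriorPoint_iff_of_mem_atlas` for the maximal atlas).
[cite: LeeSmoothManifolds2013, Thm. 1.46] -/
theorem isInteriorPoint_iff_of_mem_maximalAtlas [IsManifold I m M] (hm : m ≠ 0)
    (he : e ∈ IsManifold.maximalAtlas I m M) (hx : x ∈ e.source) :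
    I.IsInteriorPoint x ↔ e.extend I x ∈ interior (range I) := by
  rw [I.isInteriorPoint_iff, extChartAt, mem_interior_extend_target_iff_of_mem_maximalAtlas hm
    (IsManifold.chart_mem_maximalAtlas x) he (mem_chart_source H x) hx]
  refine ⟨fun h => e.interior_extend_target_subset_interior_range h, fun h => ?_⟩
  exact e.mem_interior_extend_target (e.map_source hx) h

/-- Boundary points are sent to the frontier of the model by every chart of the maximal atlas.
[cite: LeeSmoothManifolds2013, Thm. 1.46] -/
theorem isBoundaryPoint_iff_of_mem_maximalAtlas [IsManifold I m M] (hm : m ≠ 0)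
    (he : e ∈ IsManifold.maximalAtlas I m M) (hx : x ∈ e.source) :
    I.IsBoundaryPoint x ↔ e.extend I x ∈ frontier (range I) := by
  rw [← not_iff_not, ← I.isInteriorPoint_iff_not_isBoundaryPoint,
    isInteriorPoint_iff_of_mem_maximalAtlas hm he hx]
  have hr : e.extend I x ∈ range I := by simp
  rw [← closure_sdiff_interior, I.isClosed_range.closure_eq, mem_sdiff]
  tauto

end Invariance

/-! ### Notation and the closed ball -/

/-- Local notation for the model space `ℝⁿ`. -/
local notation "𝔼 " n:arg => EuclideanSpace ℝ (Fin n)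
/-- Local notation for the unit sphere `𝕊ⁿ ⊆ ℝⁿ⁺¹`. -/
local notation "𝕊 " n:arg => (Metric.sphere (0 : EuclideanSpace ℝ (Fin (n + 1))) 1)
/-- Local notation for the closed unit ball `𝔻ⁿ ⊆ ℝⁿ`. -/
local notation "𝔻 " n:arg => (Metric.closedBall (0 : EuclideanSpace ℝ (Fin n)) 1)

section Ball

variable {n : ℕ}

/-- **Boundary invariance on the disc**: a chart of the maximal `C^∞` atlas of `𝔻ⁿ⁺¹` sends a
point `x` of its source into the open half space `{u | 0 < u 0}` iff `‖x‖ < 1`.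
[cite: LeeSmoothManifolds2013, Thm. 1.46] -/
theorem norm_lt_one_iff_of_mem_maximalAtlas
    {e : OpenPartialHomeomorph (𝔻 (n + 1)) (EuclideanHalfSpace (n + 1))}
    (he : e ∈ IsManifold.maximalAtlas (𝓡∂ (n + 1)) ∞ (𝔻 (n + 1))) {x : 𝔻 (n + 1)}
    (hx : x ∈ e.source) : ‖(x : 𝔼 (n + 1))‖ < 1 ↔ 0 < (e x).val 0 := by
  have h1 : ‖(x : 𝔼 (n + 1))‖ < 1 ↔ (𝓡∂ (n + 1)).IsInteriorPoint x := by
    change _ ↔ x ∈ (𝓡∂ (n + 1)).interior (𝔻 (n + 1))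
    rw [interior_closedBall]
    rfl
  rw [h1, isInteriorPoint_iff_of_mem_maximalAtlas (by simp) he hx,
    interior_range_modelWithCornersEuclideanHalfSpace]
  rfl

/-- A chart of the maximal atlas of `𝔻ⁿ⁺¹` sends `x` to the boundary hyperplane `{u 0 = 0}` iff
`‖x‖ = 1`. [cite: LeeSmoothManifolds2013, Thm. 1.46] -/
theorem norm_eq_one_iff_of_mem_maximalAtlas
    {e : OpenPartialHomeomorph (𝔻 (n + 1)) (EuclideanHalfSpace (n + 1))}
    (he : e ∈ IsManifold.maximalAtlas (𝓡∂ (n + 1)) ∞ (𝔻 (n + 1))) {x : 𝔻 (n + 1)}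
    (hx : x ∈ e.source) : ‖(x : 𝔼 (n + 1))‖ = 1 ↔ (e x).val 0 = 0 := by
  have h1 := norm_lt_one_iff_of_mem_maximalAtlas he hx
  have h2 : ‖(x : 𝔼 (n + 1))‖ ≤ 1 := mem_closedBall_zero_iff.1 x.2
  have h3 : 0 ≤ (e x).val 0 := (e x).2
  constructor
  · intro h
    exact le_antisymm (not_lt.1 fun h' => (h1.2 h').ne h) h3
  · intro h
    exact h2.antisymm (not_lt.1 fun h' => (h1.1 h').ne' h)

/-- The inclusion `𝕊ⁿ ↪ 𝔻ⁿ⁺¹` of the boundary sphere (abbreviation used throughout). [folklore] -/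
abbrev sphereToBall (n : ℕ) : (𝕊 n) → 𝔻 (n + 1) := Set.inclusion sphere_subset_closedBall

/-- The inclusion of the boundary sphere, on underlying vectors (definitional). [folklore] -/
@[simp]
theorem coe_sphereToBall (z : 𝕊 n) : ((sphereToBall n z : 𝔻 (n + 1)) : 𝔼 (n + 1)) = z := rfl

/-- Points of the boundary sphere have norm one. [folklore] -/
theorem norm_sphereToBall (z : 𝕊 n) : ‖((sphereToBall n z : 𝔻 (n + 1)) : 𝔼 (n + 1))‖ = 1 := by
  simp

/-- The inclusion of the boundary sphere is injective. [folklore] -/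
theorem sphereToBall_injective : Injective (sphereToBall n) := Set.inclusion_injective _

/-- A point of `𝔻ⁿ⁺¹` of norm one is in the image of the boundary sphere. [folklore] -/
theorem exists_sphereToBall_eq {a : 𝔻 (n + 1)} (ha : ‖(a : 𝔼 (n + 1))‖ = 1) :
    ∃ z : 𝕊 n, sphereToBall n z = a :=
  ⟨⟨a, mem_sphere_zero_iff_norm.2 ha⟩, Subtype.ext rfl⟩

/-- The inclusion of the boundary sphere is smooth (the tree's instance
`fact_isSmoothEmbedding_sphereInclusion'`). [folklore] -/
theorem contMDiff_sphereToBall : ContMDiff (𝓡 n) (𝓡∂ (n + 1)) ∞ (sphereToBall n) :=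
  (isSmoothEmbedding_sphereInclusion'_holds n).contMDiff

/-- The closed ball retraction `ℝⁿ⁺¹ → 𝔻ⁿ⁺¹` is `C^∞` (for the manifold-with-boundary structure
on the target) *within the closed ball* at every point of the closed ball, where it is the
identity. Lee (2013), Ch. 1, Problem 1-11. [folklore] -/
theorem contMDiffWithinAt_closedBallRetraction {x : 𝔼 (n + 1)} (hx : ‖x‖ ≤ 1) :
    ContMDiffWithinAt 𝓘(ℝ, 𝔼 (n + 1)) (𝓡∂ (n + 1)) ∞ (closedBallRetraction (n + 1))
      (closedBall (0 : 𝔼 (n + 1)) 1) x := by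
  have hf : ContMDiffWithinAt 𝓘(ℝ, 𝔼 (n + 1)) 𝓘(ℝ, 𝔼 (n + 1)) ∞
      (fun y => ((closedBallRetraction (n + 1) y : 𝔻 (n + 1)) : 𝔼 (n + 1)))
      (closedBall (0 : 𝔼 (n + 1)) 1) x :=
    contMDiffWithinAt_id.congr
      (fun y hy => closedBallRetraction_of_norm_le (n + 1) (mem_closedBall_zero_iff.1 hy))
      (closedBallRetraction_of_norm_le (n + 1) hx)
  rw [contMDiffWithinAt_iff_target]
  refine ⟨Topology.IsInducing.subtypeVal.continuousWithinAt_iff.2 hf.continuousWithinAt, ?_⟩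
  have hxr : ((closedBallRetraction (n + 1) x : 𝔻 (n + 1)) : 𝔼 (n + 1)) = x :=
    closedBallRetraction_of_norm_le (n + 1) hx
  by_cases h1 : ‖x‖ < 1
  · have hlt : ‖((closedBallRetraction (n + 1) x : 𝔻 (n + 1)) : 𝔼 (n + 1))‖ < 1 := by
      rwa [hxr]
    have key : extChartAt (𝓡∂ (n + 1)) (closedBallRetraction (n + 1) x) ∘
        closedBallRetraction (n + 1) =
          fun y => ((closedBallRetraction (n + 1) y : 𝔻 (n + 1)) : 𝔼 (n + 1)) +
            (2 : ℝ) • closedBallBaseVector n := by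
      funext y
      rw [extChartAt, closedBall_chartAt_of_norm_lt_one hlt]
      rfl
    rw [key]
    exact hf.add contMDiffWithinAt_const
  · have heq : ‖((closedBallRetraction (n + 1) x : 𝔻 (n + 1)) : 𝔼 (n + 1))‖ = 1 := by
      rw [hxr]; exact hx.antisymm (not_lt.1 h1)
    set p : 𝕊 n := ⟨(closedBallRetraction (n + 1) x : 𝔻 (n + 1)), mem_sphere_zero_iff_norm.2 heq⟩
      with hp
    have key : extChartAt (𝓡∂ (n + 1)) (closedBallRetraction (n + 1) x) ∘
        closedBallRetraction (n + 1) =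
          polarChart p ∘ fun y => ((closedBallRetraction (n + 1) y : 𝔻 (n + 1)) : 𝔼 (n + 1)) := by
      funext y
      rw [extChartAt, closedBall_chartAt_of_norm_eq_one heq]
      rfl
    rw [key]
    have hps : (p : 𝔼 (n + 1)) ∈ (polarChart p).source := mem_polarChart_source_self p
    have hpx : (p : 𝔼 (n + 1)) = x := hxr
    refine ContMDiffAt.comp_contMDiffWithinAt x ?_ hf
    rw [hxr, ← hpx]
    exact ((contDiffOn_polarChart p).contDiffAt ((polarChart p).open_source.mem_nhds hps)).contMDiffAt

/-- **Smoothness on the disc read within the closed ball.** If `g : 𝔻ⁿ⁺¹ → F` is `C^∞` at `x`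
for the manifold-with-boundary structure, then `g ∘ closedBallRetraction` is `C^∞` within the
closed ball at `x` as a map on `ℝⁿ⁺¹` (one-sided derivatives at the boundary sphere).
Lee (2013), Ch. 1, Problem 1-11. [folklore] -/
theorem contDiffWithinAt_comp_closedBallRetraction {F : Type*} [NormedAddCommGroup F]
    [NormedSpace ℝ F] {g : (𝔻 (n + 1)) → F} {x : 𝔻 (n + 1)}
    (hg : ContMDiffAt (𝓡∂ (n + 1)) 𝓘(ℝ, F) ∞ g x) :
    ContDiffWithinAt ℝ ∞ (fun y => g (closedBallRetraction (n + 1) y))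
      (closedBall (0 : 𝔼 (n + 1)) 1) x := by
  have hx : ‖(x : 𝔼 (n + 1))‖ ≤ 1 := mem_closedBall_zero_iff.1 x.2
  have h1 := contMDiffWithinAt_closedBallRetraction hx
  have h2 : closedBallRetraction (n + 1) (x : 𝔼 (n + 1)) = x :=
    Subtype.ext (closedBallRetraction_of_norm_le (n + 1) hx)
  rw [← h2] at hg
  exact contMDiffWithinAt_iff_contDiffWithinAt.1 (hg.comp_contMDiffWithinAt _ h1)

/-- `On` version of `contDiffWithinAt_comp_closedBallRetraction`: if `g` is `C^∞` on an open set
`U ⊆ 𝔻ⁿ⁺¹` then `g ∘ closedBallRetraction` is `C^∞` on `Subtype.val '' U` within the closed ball.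
[folklore] -/
theorem contDiffOn_comp_closedBallRetraction {F : Type*} [NormedAddCommGroup F]
    [NormedSpace ℝ F] {g : (𝔻 (n + 1)) → F} {U : Set (𝔻 (n + 1))} (hU : IsOpen U)
    (hg : ContMDiffOn (𝓡∂ (n + 1)) 𝓘(ℝ, F) ∞ g U) :
    ContDiffOn ℝ ∞ (fun y => g (closedBallRetraction (n + 1) y))
      ((Subtype.val : (𝔻 (n + 1)) → 𝔼 (n + 1)) '' U) := by
  rintro _ ⟨x, hxU, rfl⟩
  have h := contDiffWithinAt_comp_closedBallRetraction (hg.contMDiffAt (hU.mem_nhds hxU))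
  exact h.mono (by rintro _ ⟨y, -, rfl⟩; exact y.2)

end Ball

/-! ### Embeddings of the disc: a left inverse -/

section EmbInv

variable {n : ℕ} {P : Type*}

/-- A (total) left inverse `P → 𝔻ⁿ⁺¹` of a map `j : 𝔻ⁿ⁺¹ → P` (by `Function.invFun`; meaningful on
`range j` for injective `j`). [folklore] -/
def ballEmbeddingInv (j : (𝔻 (n + 1)) → P) : P → 𝔻 (n + 1) :=
  haveI : Nonempty (𝔻 (n + 1)) := ⟨⟨0, by simp⟩⟩
  Function.invFun j

/-- The left inverse inverts `j` on the left for injective `j`. [folklore] -/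
theorem ballEmbeddingInv_apply {j : (𝔻 (n + 1)) → P} (hj : Injective j) (a : 𝔻 (n + 1)) :
    ballEmbeddingInv j (j a) = a := by
  haveI : Nonempty (𝔻 (n + 1)) := ⟨⟨0, by simp⟩⟩
  exact Function.leftInverse_invFun hj a

/-- The left inverse is a right inverse on `range j`. [folklore] -/
theorem apply_ballEmbeddingInv {j : (𝔻 (n + 1)) → P} {p : P} (hp : p ∈ range j) :
    j (ballEmbeddingInv j p) = p := by
  haveI : Nonempty (𝔻 (n + 1)) := ⟨⟨0, by simp⟩⟩
  exact Function.invFun_eq hp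

end EmbInv

/-! ### Immersion data in equal dimensions: the normal chart -/

section NormalChart

variable {n : ℕ} {P : Type*} [TopologicalSpace P] [ChartedSpace (𝔼 (n + 1)) P]
  {j : (𝔻 (n + 1)) → P} {x : 𝔻 (n + 1)}

/-- The **linear part** of Mathlib's immersion data of `j : 𝔻ⁿ⁺¹ → P` at `x` (equal dimensions):
`u ↦ h.equiv (u, 0)`, an injective linear endomorphism of `ℝⁿ⁺¹`, hence an automorphism (the
complement `h.complement` is zero-dimensional, but this is not needed). [folklore] -/
def _root_.Manifold.IsImmersionAt.linearPart
    (h : Manifold.IsImmersionAt (𝓡∂ (n + 1)) (𝓡 (n + 1)) ∞ j x) :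
    (𝔼 (n + 1)) ≃L[ℝ] 𝔼 (n + 1) :=
  LinearEquiv.toContinuousLinearEquiv
    (LinearEquiv.ofInjectiveEndo
      ((h.equiv : (𝔼 (n + 1)) × h.complement →L[ℝ] 𝔼 (n + 1)).toLinearMap ∘ₗ
        LinearMap.inl ℝ (𝔼 (n + 1)) h.complement)
      (by
        intro u v huv
        have : ((u, 0) : (𝔼 (n + 1)) × h.complement) = (v, 0) := h.equiv.injective huv
        exact congrArg Prod.fst this))

/-- The linear part is `u ↦ h.equiv (u, 0)` (definitional). [folklore] -/
@[simp]
theorem _root_.Manifold.IsImmersionAt.linearPart_apply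
    (h : Manifold.IsImmersionAt (𝓡∂ (n + 1)) (𝓡 (n + 1)) ∞ j x) (u : 𝔼 (n + 1)) :
    h.linearPart u = h.equiv (u, 0) := rfl

/-- The inverse of the linear part, as a partial homeomorphism of `ℝⁿ⁺¹` (source and target
`univ`). [folklore] -/
def _root_.Manifold.IsImmersionAt.linearPartSymmChart
    (h : Manifold.IsImmersionAt (𝓡∂ (n + 1)) (𝓡 (n + 1)) ∞ j x) :
    OpenPartialHomeomorph (𝔼 (n + 1)) (𝔼 (n + 1)) :=
  h.linearPart.symm.toHomeomorph.toOpenPartialHomeomorph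

/-- Unfolding lemma (definitional). [folklore] -/
@[simp]
theorem _root_.Manifold.IsImmersionAt.linearPartSymmChart_apply
    (h : Manifold.IsImmersionAt (𝓡∂ (n + 1)) (𝓡 (n + 1)) ∞ j x) (u : 𝔼 (n + 1)) :
    h.linearPartSymmChart u = h.linearPart.symm u := rfl

/-- Unfolding lemma (definitional). [folklore] -/
@[simp]
theorem _root_.Manifold.IsImmersionAt.linearPartSymmChart_symm_apply
    (h : Manifold.IsImmersionAt (𝓡∂ (n + 1)) (𝓡 (n + 1)) ∞ j x) (u : 𝔼 (n + 1)) :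
    h.linearPartSymmChart.symm u = h.linearPart u := rfl

/-- The source is everything (definitional). [folklore] -/
@[simp]
theorem _root_.Manifold.IsImmersionAt.linearPartSymmChart_source
    (h : Manifold.IsImmersionAt (𝓡∂ (n + 1)) (𝓡 (n + 1)) ∞ j x) :
    h.linearPartSymmChart.source = univ := rfl

/-- The target is everything (definitional). [folklore] -/
@[simp]
theorem _root_.Manifold.IsImmersionAt.linearPartSymmChart_target
    (h : Manifold.IsImmersionAt (𝓡∂ (n + 1)) (𝓡 (n + 1)) ∞ j x) :
    h.linearPartSymmChart.target = univ := rfl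

/-- The **normal chart** of `P` at `j x` attached to the immersion data of `j` at `x`: the codomain
chart followed by the inverse of the linear part. In it, `j` reads as the (extended) domain chart:
`normalChart (j y) = (domChart y).val` (`normalChart_apply_of_mem`). [folklore] -/
def _root_.Manifold.IsImmersionAt.normalChart
    (h : Manifold.IsImmersionAt (𝓡∂ (n + 1)) (𝓡 (n + 1)) ∞ j x) :
    OpenPartialHomeomorph P (𝔼 (n + 1)) :=
  h.codChart ≫ₕ h.linearPartSymmChart

/-- The normal chart has the source of the codomain chart. [folklore] -/
theorem _root_.Manifold.IsImmersionAt.normalChart_source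
    (h : Manifold.IsImmersionAt (𝓡∂ (n + 1)) (𝓡 (n + 1)) ∞ j x) :
    h.normalChart.source = h.codChart.source := by
  simp [Manifold.IsImmersionAt.normalChart]

/-- Unfolding lemma for the normal chart (definitional). [folklore] -/
theorem _root_.Manifold.IsImmersionAt.normalChart_apply
    (h : Manifold.IsImmersionAt (𝓡∂ (n + 1)) (𝓡 (n + 1)) ∞ j x) (p : P) :
    h.normalChart p = h.linearPart.symm (h.codChart p) := rfl

/-- `j` maps the source of the domain chart into the source of the normal chart. [folklore] -/
theorem _root_.Manifold.IsImmersionAt.mem_normalChart_source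
    (h : Manifold.IsImmersionAt (𝓡∂ (n + 1)) (𝓡 (n + 1)) ∞ j x)
    {y : 𝔻 (n + 1)} (hy : y ∈ h.domChart.source) : j y ∈ h.normalChart.source := by
  rw [Manifold.IsImmersionAt.normalChart_source]
  exact h.source_subset_preimage_source hy

/-- The normal chart lies in the maximal atlas (it differs from the codomain chart by a linear
automorphism of the model). [folklore] -/
theorem _root_.Manifold.IsImmersionAt.normalChart_mem_maximalAtlas [IsManifold (𝓡 (n + 1)) ∞ P]
    (h : Manifold.IsImmersionAt (𝓡∂ (n + 1)) (𝓡 (n + 1)) ∞ j x) :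
    h.normalChart ∈ IsManifold.maximalAtlas (𝓡 (n + 1)) ∞ P := by
  refine trans_mem_maximalAtlas_of_contDiffOn h.codChart_mem_maximalAtlas _ ?_ ?_
  · have : (h.linearPartSymmChart : (𝔼 (n + 1)) → 𝔼 (n + 1)) = h.linearPart.symm :=
      funext h.linearPartSymmChart_apply
    rw [this]
    exact h.linearPart.symm.contDiff.contDiffOn
  · have : (h.linearPartSymmChart.symm : (𝔼 (n + 1)) → 𝔼 (n + 1)) = h.linearPart :=
      funext h.linearPartSymmChart_symm_apply
    rw [this]
    exact h.linearPart.contDiff.contDiffOn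

/-- **In the normal chart, `j` is the domain chart**: `normalChart (j y) = (domChart y).val` for
`y` in the source of the domain chart (Mathlib's `writtenInCharts`, unwound). [folklore] -/
theorem _root_.Manifold.IsImmersionAt.normalChart_apply_of_mem
    (h : Manifold.IsImmersionAt (𝓡∂ (n + 1)) (𝓡 (n + 1)) ∞ j x)
    {y : 𝔻 (n + 1)} (hy : y ∈ h.domChart.source) :
    h.normalChart (j y) = (h.domChart y).val := by
  have hmem : (h.domChart.extend (𝓡∂ (n + 1))) y ∈ (h.domChart.extend (𝓡∂ (n + 1))).target :=
    (h.domChart.extend (𝓡∂ (n + 1))).map_source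
      (by rw [OpenPartialHomeomorph.extend_source]; exact hy)
  have hw := h.writtenInCharts hmem
  simp only [comp_apply] at hw
  rw [OpenPartialHomeomorph.extend_left_inv _ hy] at hw
  have h1 : (h.codChart.extend (𝓡 (n + 1))) (j y) = h.codChart (j y) := by
    rw [OpenPartialHomeomorph.extend_coe, comp_apply, modelWithCornersSelf_coe, id]
  have h2 : (h.domChart.extend (𝓡∂ (n + 1))) y = (h.domChart y).val := by
    rw [OpenPartialHomeomorph.extend_coe, comp_apply, modelWithCornersEuclideanHalfSpace_apply]
  rw [h1, h2] at hw
  rw [Manifold.IsImmersionAt.normalChart_apply, ContinuousLinearEquiv.symm_apply_eq,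
    Manifold.IsImmersionAt.linearPart_apply, hw]

/-- **The inverse of a smooth embedding of the disc, read in a chart, is `C^∞` up to the
boundary.** For a smooth embedding `j : 𝔻ⁿ⁺¹ → P` (models `𝓡∂ (n + 1)`, `𝓡 (n + 1)`) and a chart
`c` of the maximal atlas of `P`, the map `u ↦ (j⁻¹ (c⁻¹ u) : ℝⁿ⁺¹)` is `C^∞` on
`c '' (range j ∩ c.source)` (`ContDiffOn`: derivatives within this set, which near the image of
a boundary point is a half-ball up to diffeomorphism). Locally it factors as
`(domChart⁻¹) ∘ (linear part)⁻¹ ∘ (codChart ∘ c⁻¹)`. [folklore] -/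
theorem contDiffOn_coe_ballEmbeddingInv_symm [IsManifold (𝓡 (n + 1)) ∞ P]
    (hj : Manifold.IsSmoothEmbedding (𝓡∂ (n + 1)) (𝓡 (n + 1)) ∞ j)
    {c : OpenPartialHomeomorph P (𝔼 (n + 1))} (hc : c ∈ IsManifold.maximalAtlas (𝓡 (n + 1)) ∞ P) :
    ContDiffOn ℝ ∞ (fun u => ((ballEmbeddingInv j (c.symm u) : 𝔻 (n + 1)) : 𝔼 (n + 1)))
      (c '' (range j ∩ c.source)) := by
  apply contDiffOn_of_locally_contDiffOn
  rintro _ ⟨_, ⟨⟨a, rfl⟩, hac⟩, rfl⟩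
  have h : Manifold.IsImmersionAt (𝓡∂ (n + 1)) (𝓡 (n + 1)) ∞ j a := hj.isImmersion.isImmersionAt a
  set e := h.domChart with he_def
  have he : e ∈ IsManifold.maximalAtlas (𝓡∂ (n + 1)) ∞ (𝔻 (n + 1)) := h.domChart_mem_maximalAtlas
  set c' := h.normalChart with hc'_def
  have hc' : c' ∈ IsManifold.maximalAtlas (𝓡 (n + 1)) ∞ P := h.normalChart_mem_maximalAtlas
  obtain ⟨W, hWo, hWe⟩ := hj.isEmbedding.toIsInducing.isOpen_iff.1 e.open_source
  refine ⟨c.target ∩ c.symm ⁻¹' (c'.source ∩ W),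
    c.isOpen_inter_preimage_symm (c'.open_source.inter hWo), ⟨c.map_source hac, ?_⟩, ?_⟩
  · rw [mem_preimage, c.left_inv hac]
    refine ⟨h.mem_normalChart_source h.mem_domChart_source, ?_⟩
    rw [← mem_preimage, hWe]
    exact h.mem_domChart_source
  · -- on this set the function is `(e.extend)⁻¹ ∘ c' ∘ c⁻¹`
    have hT : ContDiffOn ℝ ∞
        (fun v => (((e.extend (𝓡∂ (n + 1))).symm v : 𝔻 (n + 1)) : 𝔼 (n + 1)))
        ((e.extend (𝓡∂ (n + 1))).target) := by
      have h1 := (contMDiff_coe_closedBall (n := n)).comp_contMDiffOn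
        (contMDiffOn_extend_symm he)
      rw [← OpenPartialHomeomorph.extend_target'] at h1
      exact contMDiffOn_iff_contDiffOn.1 h1
    have hS : ContDiffOn ℝ ∞ (c' ∘ c.symm) (c.target ∩ c.symm ⁻¹' c'.source) := by
      have h1 := (𝓡 (n + 1)).contDiffOn_extendCoordChange hc hc'
      rw [ModelWithCorners.extendCoordChange_source] at h1
      refine (h1.mono ?_).congr ?_
      · intro u hu
        refine ⟨u, ?_, by simp⟩
        simpa [OpenPartialHomeomorph.trans_source] using hu
      · intro u hu
        simp [ModelWithCorners.extendCoordChange]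
    refine (hT.comp (hS.mono ?_) ?_).congr ?_
    · rintro u ⟨-, hu1, hu2⟩
      exact ⟨hu1, hu2.1⟩
    · rintro _ ⟨⟨_, ⟨⟨y, rfl⟩, hyc⟩, rfl⟩, -, hy2⟩
      rw [mem_preimage, c.left_inv hyc] at hy2
      have hye : y ∈ e.source := by rw [← hWe]; exact hy2.2
      simp only [comp_apply, c.left_inv hyc, hc'_def, h.normalChart_apply_of_mem hye]
      exact (e.extend (𝓡∂ (n + 1))).map_source (by simpa using hye)
    · rintro _ ⟨⟨_, ⟨⟨y, rfl⟩, hyc⟩, rfl⟩, -, hy2⟩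
      rw [mem_preimage, c.left_inv hyc] at hy2
      have hye : y ∈ e.source := by rw [← hWe]; exact hy2.2
      simp only [comp_apply, c.left_inv hyc, ballEmbeddingInv_apply hj.isEmbedding.injective,
        hc'_def, h.normalChart_apply_of_mem hye]
      have hval : (e y).val = (e.extend (𝓡∂ (n + 1))) y := by
        rw [OpenPartialHomeomorph.extend_coe, comp_apply, modelWithCornersEuclideanHalfSpace_apply]
      rw [hval, OpenPartialHomeomorph.extend_left_inv _ hye]

end NormalChart

/-! ### Gluing data of two discs -/

section Gluing

variable (n : ℕ)

/-- **Gluing data of two discs.** Witnesses realising the charted space `P` (model `ℝⁿ⁺¹`) as the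
gluing `𝔻ⁿ⁺¹ ∪_φ 𝔻ⁿ⁺¹` of two closed discs along the diffeomorphism `φ` of `𝕊ⁿ = ∂𝔻ⁿ⁺¹`: two
smooth embeddings `jA, jB : 𝔻ⁿ⁺¹ → P` whose ranges cover `P`, with `jA a = jB b` exactly when
`a = z` and `b = φ z` for a point `z` of the boundary sphere. This is the data of
`Literature.IsTwistedSphere n φ P` (`TwistedSpheres.lean`, an `∃`-statement), made available by
`Literature.Topology.FourManifolds.IsTwistedSphere.nonempty_ballGluingData`. Hirsch (1976), Ch. 8 §2; Milnor (1965), §9.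
[cite: HirschDT1976, Ch. 8 §2] -/
structure BallGluingData (φ : (𝕊 n) ≃ₘ⟮𝓡 n, 𝓡 n⟯ (𝕊 n)) (P : Type*) [TopologicalSpace P]
    [ChartedSpace (𝔼 (n + 1)) P] where
  /-- The first disc. -/
  jA : (𝔻 (n + 1)) → P
  /-- The second disc. -/
  jB : (𝔻 (n + 1)) → P
  /-- The first disc is smoothly embedded. -/
  isSmoothEmbedding_jA : Manifold.IsSmoothEmbedding (𝓡∂ (n + 1)) (𝓡 (n + 1)) ∞ jA
  /-- The second disc is smoothly embedded. -/
  isSmoothEmbedding_jB : Manifold.IsSmoothEmbedding (𝓡∂ (n + 1)) (𝓡 (n + 1)) ∞ jB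
  /-- The two discs cover `P`. -/
  range_union : range jA ∪ range jB = univ
  /-- The two discs meet exactly along `∂𝔻ⁿ⁺¹ ≡_φ ∂𝔻ⁿ⁺¹`. -/
  apply_eq_apply_iff : ∀ a b, jA a = jB b ↔
    ∃ z : 𝕊 n, a = sphereToBall n z ∧ b = sphereToBall n (φ z)

variable {n} {φ : (𝕊 n) ≃ₘ⟮𝓡 n, 𝓡 n⟯ (𝕊 n)} {P : Type*} [TopologicalSpace P]
  [ChartedSpace (𝔼 (n + 1)) P]

/-- A twisted sphere `Σ(φ)` carries gluing data (choice of the witnesses). [folklore] -/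
theorem IsTwistedSphere.nonempty_ballGluingData [Fact (isSmoothEmbedding_sphereInclusion' n)]
    (h : IsTwistedSphere n φ P) : Nonempty (BallGluingData n φ P) := by
  obtain ⟨jA, jB, hA, hB, hU, hR⟩ := h
  exact ⟨⟨jA, jB, hA, hB, hU, fun a b => by simpa using hR a b⟩⟩

/-- Conversely gluing data make `P` a twisted sphere `Σ(φ)`. [folklore] -/
theorem BallGluingData.isTwistedSphere [Fact (isSmoothEmbedding_sphereInclusion' n)]
    (G : BallGluingData n φ P) : IsTwistedSphere n φ P :=
  ⟨G.jA, G.jB, G.isSmoothEmbedding_jA, G.isSmoothEmbedding_jB, G.range_union,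
    fun a b => by simpa using G.apply_eq_apply_iff a b⟩

namespace BallGluingData

variable (G : BallGluingData n φ P)

/-- The first disc is embedded injectively. [folklore] -/
theorem injective_jA : Injective G.jA := G.isSmoothEmbedding_jA.isEmbedding.injective

/-- The second disc is embedded injectively. [folklore] -/
theorem injective_jB : Injective G.jB := G.isSmoothEmbedding_jB.isEmbedding.injective

/-- The first embedding is continuous. [folklore] -/
theorem continuous_jA : Continuous G.jA := G.isSmoothEmbedding_jA.isEmbedding.continuous

/-- The second embedding is continuous. [folklore] -/
theorem continuous_jB : Continuous G.jB := G.isSmoothEmbedding_jB.isEmbedding.continuous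

/-- The first embedding is `C^∞`. [folklore] -/
theorem contMDiff_jA : ContMDiff (𝓡∂ (n + 1)) (𝓡 (n + 1)) ∞ G.jA := G.isSmoothEmbedding_jA.contMDiff

/-- The second embedding is `C^∞`. [folklore] -/
theorem contMDiff_jB : ContMDiff (𝓡∂ (n + 1)) (𝓡 (n + 1)) ∞ G.jB := G.isSmoothEmbedding_jB.contMDiff

/-- On the seam: `jA z = jB (φ z)`. [folklore] -/
theorem jA_sphereToBall (z : 𝕊 n) : G.jA (sphereToBall n z) = G.jB (sphereToBall n (φ z)) :=
  (G.apply_eq_apply_iff _ _).2 ⟨z, rfl, rfl⟩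

/-- On the seam: `jB w = jA (φ⁻¹ w)`. [folklore] -/
theorem jB_sphereToBall (w : 𝕊 n) : G.jB (sphereToBall n w) = G.jA (sphereToBall n (φ.symm w)) := by
  rw [G.jA_sphereToBall, Diffeomorph.apply_symm_apply]

/-- If `jA a = jB b` then `a` lies on the boundary sphere. [folklore] -/
theorem norm_eq_one_left {a b : 𝔻 (n + 1)} (h : G.jA a = G.jB b) : ‖(a : 𝔼 (n + 1))‖ = 1 := by
  obtain ⟨z, rfl, -⟩ := (G.apply_eq_apply_iff a b).1 h
  simp

/-- If `jA a = jB b` then `b` lies on the boundary sphere. [folklore] -/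
theorem norm_eq_one_right {a b : 𝔻 (n + 1)} (h : G.jA a = G.jB b) : ‖(b : 𝔼 (n + 1))‖ = 1 := by
  obtain ⟨z, -, rfl⟩ := (G.apply_eq_apply_iff a b).1 h
  simp

/-- Every point of `P` lies in one of the two discs. [folklore] -/
theorem mem_range_or (p : P) : p ∈ range G.jA ∨ p ∈ range G.jB := by
  have : p ∈ range G.jA ∪ range G.jB := by rw [G.range_union]; exact mem_univ p
  exact this

/-- A point off the second disc is an interior point of the first disc. [folklore] -/
theorem exists_norm_lt_one_of_notMem_range_jB {p : P} (hp : p ∉ range G.jB) :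
    ∃ a : 𝔻 (n + 1), ‖(a : 𝔼 (n + 1))‖ < 1 ∧ G.jA a = p := by
  obtain ⟨a, rfl⟩ := (G.mem_range_or p).resolve_right hp
  refine ⟨a, lt_of_le_of_ne (mem_closedBall_zero_iff.1 a.2) fun ha => hp ?_, rfl⟩
  obtain ⟨z, rfl⟩ := exists_sphereToBall_eq ha
  exact ⟨_, (G.jA_sphereToBall z).symm⟩

/-- Interior points of the first disc are off the second disc. [folklore] -/
theorem jA_notMem_range_jB {a : 𝔻 (n + 1)} (ha : ‖(a : 𝔼 (n + 1))‖ < 1) : G.jA a ∉ range G.jB := by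
  rintro ⟨b, hb⟩
  exact ha.ne (G.norm_eq_one_left hb.symm)

/-- Interior points of the second disc are off the first disc. [folklore] -/
theorem jB_notMem_range_jA {b : 𝔻 (n + 1)} (hb : ‖(b : 𝔼 (n + 1))‖ < 1) : G.jB b ∉ range G.jA := by
  rintro ⟨a, ha⟩
  exact hb.ne (G.norm_eq_one_right ha)

/-- A point off the first disc is an interior point of the second disc. [folklore] -/
theorem exists_norm_lt_one_of_notMem_range_jA {p : P} (hp : p ∉ range G.jA) :
    ∃ b : 𝔻 (n + 1), ‖(b : 𝔼 (n + 1))‖ < 1 ∧ G.jB b = p := by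
  obtain ⟨b, rfl⟩ := (G.mem_range_or p).resolve_left hp
  refine ⟨b, lt_of_le_of_ne (mem_closedBall_zero_iff.1 b.2) fun hb => hp ?_, rfl⟩
  obtain ⟨w, rfl⟩ := exists_sphereToBall_eq hb
  exact ⟨_, (G.jB_sphereToBall w).symm⟩

/-- **The glued manifold is compact** (union of two discs). [folklore] -/
theorem compactSpace (G : BallGluingData n φ P) : CompactSpace P := by
  refine ⟨?_⟩
  rw [← G.range_union]
  exact (isCompact_range G.continuous_jA).union (isCompact_range G.continuous_jB)

/-- **Symmetry of gluing data**: `𝔻 ∪_φ 𝔻 = 𝔻 ∪_{φ⁻¹} 𝔻` with the discs swapped. [folklore] -/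
def symm : BallGluingData n φ.symm P where
  jA := G.jB
  jB := G.jA
  isSmoothEmbedding_jA := G.isSmoothEmbedding_jB
  isSmoothEmbedding_jB := G.isSmoothEmbedding_jA
  range_union := by rw [union_comm]; exact G.range_union
  apply_eq_apply_iff a b := by
    rw [eq_comm, G.apply_eq_apply_iff]
    constructor
    · rintro ⟨z, rfl, rfl⟩
      exact ⟨φ z, rfl, by simp⟩
    · rintro ⟨w, rfl, rfl⟩
      exact ⟨φ.symm w, rfl, by simp⟩

/-- The first disc of the swapped data is the second disc (definitional). [folklore] -/
@[simp] theorem symm_jA : G.symm.jA = G.jB := rfl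

/-- The second disc of the swapped data is the first disc (definitional). [folklore] -/
@[simp] theorem symm_jB : G.symm.jB = G.jA := rfl

/-- The left inverse of the first disc. [folklore] -/
def invA : P → 𝔻 (n + 1) := ballEmbeddingInv G.jA

/-- The left inverse of the second disc. [folklore] -/
def invB : P → 𝔻 (n + 1) := ballEmbeddingInv G.jB

/-- `jA⁻¹ ∘ jA = id`. [folklore] -/
@[simp] theorem invA_jA (a : 𝔻 (n + 1)) : G.invA (G.jA a) = a := ballEmbeddingInv_apply G.injective_jA a

/-- `jB⁻¹ ∘ jB = id`. [folklore] -/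
@[simp] theorem invB_jB (b : 𝔻 (n + 1)) : G.invB (G.jB b) = b := ballEmbeddingInv_apply G.injective_jB b

/-- `jA ∘ jA⁻¹ = id` on `range jA`. [folklore] -/
theorem jA_invA {p : P} (hp : p ∈ range G.jA) : G.jA (G.invA p) = p := apply_ballEmbeddingInv hp

/-- `jB ∘ jB⁻¹ = id` on `range jB`. [folklore] -/
theorem jB_invB {p : P} (hp : p ∈ range G.jB) : G.jB (G.invB p) = p := apply_ballEmbeddingInv hp

/-- The left inverses of the swapped data (definitional). [folklore] -/
@[simp] theorem symm_invA : G.symm.invA = G.invB := rfl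

/-- The left inverses of the swapped data (definitional). [folklore] -/
@[simp] theorem symm_invB : G.symm.invB = G.invA := rfl

/-- The image of the open disc under `jA` is the complement of the second disc. [folklore] -/
theorem image_jA_ball_eq_compl : G.jA '' {a | ‖(a : 𝔼 (n + 1))‖ < 1} = (range G.jB)ᶜ := by
  ext p
  constructor
  · rintro ⟨a, ha, rfl⟩
    exact G.jA_notMem_range_jB ha
  · intro hp
    obtain ⟨a, ha, rfl⟩ := G.exists_norm_lt_one_of_notMem_range_jB hp
    exact ⟨a, ha, rfl⟩

variable [T2Space P]

/-- The discs are closed in `P` (Hausdorff). [folklore] -/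
theorem isClosed_range_jA : IsClosed (range G.jA) :=
  (isCompact_range G.continuous_jA).isClosed

/-- The discs are closed in `P` (Hausdorff). [folklore] -/
theorem isClosed_range_jB : IsClosed (range G.jB) :=
  (isCompact_range G.continuous_jB).isClosed

/-- The image of the open disc under `jA` is open in `P`. [folklore] -/
theorem isOpen_image_jA_ball : IsOpen (G.jA '' {a | ‖(a : 𝔼 (n + 1))‖ < 1}) := by
  rw [G.image_jA_ball_eq_compl]
  exact G.isClosed_range_jB.isOpen_compl

/-- The image of the open disc under `jB` is open in `P`. [folklore] -/
theorem isOpen_image_jB_ball : IsOpen (G.jB '' {b | ‖(b : 𝔼 (n + 1))‖ < 1}) :=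
  G.symm.isOpen_image_jA_ball

end BallGluingData

end Gluing

/-! ### Charts adapted to the seam -/

section Seam

variable {n : ℕ} {φ : (𝕊 n) ≃ₘ⟮𝓡 n, 𝓡 n⟯ (𝕊 n)} {P : Type*} [TopologicalSpace P]
  [ChartedSpace (𝔼 (n + 1)) P]

namespace BallGluingData

/-- **A chart of `P` adapted to the seam at `z ∈ 𝕊ⁿ`.** A chart `chart` of the maximal atlas of
`P` at the seam point `jA z = jB (φ z)`, with target the ball `B(center, radius)`,
`center 0 = 0`, in which the second disc `range jB` is exactly the closed upper half ball
`{u | 0 ≤ u 0}` and the first disc `range jA` exactly the closed lower half ball `{u | u 0 ≤ 0}`;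
the seam is the hyperplane `{u 0 = 0}`. Existence: `BallGluingData.seamChart`.
Hirsch (1976), Ch. 8 §2 (the smooth structure on `M ∪_φ N` near the seam). [folklore] -/
structure SeamChart (G : BallGluingData n φ P) (z : 𝕊 n) where
  /-- The chart. -/
  chart : OpenPartialHomeomorph P (𝔼 (n + 1))
  /-- It lies in the maximal `C^∞` atlas of `P`. -/
  mem_maximalAtlas : chart ∈ IsManifold.maximalAtlas (𝓡 (n + 1)) ∞ P
  /-- The centre of the target ball, the image of the seam point. -/
  center : 𝔼 (n + 1)
  /-- The radius of the target ball. -/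
  radius : ℝ
  radius_pos : 0 < radius
  center_zero : center 0 = 0
  mem_source : G.jA (sphereToBall n z) ∈ chart.source
  apply_seamPoint : chart (G.jA (sphereToBall n z)) = center
  target_eq : chart.target = ball center radius
  /-- The second disc is the upper half ball. -/
  nonneg_iff : ∀ p ∈ chart.source, 0 ≤ chart p 0 ↔ p ∈ range G.jB
  /-- The first disc is the lower half ball. -/
  nonpos_iff : ∀ p ∈ chart.source, chart p 0 ≤ 0 ↔ p ∈ range G.jA

/-- **Existence of charts adapted to the seam.** At every point of the seam of a gluing of two
discs there is a chart adapted to the seam (`SeamChart`): the normal chart of the immersion data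
of `jB` at `φ z`, in which `jB` is a chart of the disc (so that, by invariance of the boundary
for maximal-atlas charts, `range jB` is the half space and the seam the hyperplane), restricted
to a small ball. [folklore] -/
theorem nonempty_seamChart [IsManifold (𝓡 (n + 1)) ∞ P] (G : BallGluingData n φ P) (z : 𝕊 n) :
    Nonempty (G.SeamChart z) := by
  set b : 𝔻 (n + 1) := sphereToBall n (φ z) with hb_def
  have hb1 : ‖(b : 𝔼 (n + 1))‖ = 1 := norm_sphereToBall _
  have h : Manifold.IsImmersionAt (𝓡∂ (n + 1)) (𝓡 (n + 1)) ∞ G.jB b :=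
    G.isSmoothEmbedding_jB.isImmersion.isImmersionAt b
  set e := h.domChart with he_def
  have he : e ∈ IsManifold.maximalAtlas (𝓡∂ (n + 1)) ∞ (𝔻 (n + 1)) := h.domChart_mem_maximalAtlas
  have hbe : b ∈ e.source := h.mem_domChart_source
  set c₀ := h.normalChart with hc₀_def
  have hc₀ : c₀ ∈ IsManifold.maximalAtlas (𝓡 (n + 1)) ∞ P := h.normalChart_mem_maximalAtlas
  have hc₀j : ∀ y ∈ e.source, c₀ (G.jB y) = (e y).val := fun y hy => h.normalChart_apply_of_mem hy
  have hsrc : ∀ y ∈ e.source, G.jB y ∈ c₀.source := fun y hy => h.mem_normalChart_source hy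
  set u₀ : 𝔼 (n + 1) := (e b).val with hu₀_def
  have hu₀0 : u₀ 0 = 0 := (norm_eq_one_iff_of_mem_maximalAtlas he hbe).1 hb1
  obtain ⟨W, hWo, hWe⟩ := G.isSmoothEmbedding_jB.isEmbedding.toIsInducing.isOpen_iff.1 e.open_source
  obtain ⟨V, hVo, hVe⟩ := (Topology.IsInducing.subtypeVal).isOpen_iff.1 e.open_target
  have hS₁o : IsOpen (c₀ '' (c₀.source ∩ W)) :=
    c₀.isOpen_image_of_subset_source (c₀.open_source.inter hWo) inter_subset_left
  have hbW : G.jB b ∈ W := by rw [← mem_preimage, hWe]; exact hbe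
  have hu₀S : u₀ ∈ c₀ '' (c₀.source ∩ W) := ⟨G.jB b, ⟨hsrc b hbe, hbW⟩, hc₀j b hbe⟩
  have hu₀V : u₀ ∈ V := by
    have : e b ∈ e.target := e.map_source hbe
    rw [← hVe] at this
    exact this
  obtain ⟨r, hr, hrsub⟩ := Metric.isOpen_iff.1 (hS₁o.inter hVo) u₀ ⟨hu₀S, hu₀V⟩
  set s := W ∩ (c₀.source ∩ c₀ ⁻¹' ball u₀ r) with hs_def
  have hso : IsOpen s := hWo.inter (c₀.isOpen_inter_preimage isOpen_ball)
  have hcs : (c₀.restr s).source = c₀.source ∩ s := c₀.restr_source' s hso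
  -- membership in the source of the restricted chart, unfolded
  have hmem : ∀ {p : P}, p ∈ (c₀.restr s).source ↔ p ∈ c₀.source ∧ p ∈ W ∧ c₀ p ∈ ball u₀ r := by
    intro p
    rw [hcs, hs_def]
    simp only [mem_inter_iff, mem_preimage]
    tauto
  -- points of `range jB` in the source come from `e.source`
  have hB : ∀ {y : 𝔻 (n + 1)}, G.jB y ∈ (c₀.restr s).source → y ∈ e.source := by
    intro y hy
    rw [← hWe]
    exact (hmem.1 hy).2.1
  -- the upper half ball lies in the image of `range jB`
  have hup : ∀ u ∈ ball u₀ r, 0 ≤ u 0 →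
      ∃ y ∈ e.source, (e y).val = u ∧ G.jB y ∈ (c₀.restr s).source := by
    intro u hu hu0
    have huV : u ∈ V := (hrsub hu).2
    have hut : (⟨u, hu0⟩ : EuclideanHalfSpace (n + 1)) ∈ e.target := by
      rw [← hVe]; exact huV
    refine ⟨e.symm ⟨u, hu0⟩, e.map_target hut, by rw [e.right_inv hut], ?_⟩
    rw [hmem]
    refine ⟨hsrc _ (e.map_target hut), ?_, ?_⟩
    · rw [← mem_preimage, hWe]; exact e.map_target hut
    · rw [hc₀j _ (e.map_target hut), e.right_inv hut]; exact hu
  refine ⟨{ chart := c₀.restr s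
            mem_maximalAtlas := restr_mem_maximalAtlas _ hc₀ hso
            center := u₀
            radius := r
            radius_pos := hr
            center_zero := hu₀0
            mem_source := ?_
            apply_seamPoint := ?_
            target_eq := ?_
            nonneg_iff := ?_
            nonpos_iff := ?_ }⟩
  · rw [G.jA_sphereToBall, hmem]
    exact ⟨hsrc b hbe, hbW, by rw [hc₀j b hbe]; exact mem_ball_self hr⟩
  · rw [G.jA_sphereToBall, OpenPartialHomeomorph.restr_apply, hc₀j b hbe]
  · apply Subset.antisymm
    · rintro u ⟨hu, hu'⟩
      rw [hso.interior_eq, mem_preimage, hs_def] at hu'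
      have := hu'.2.2
      rw [mem_preimage, c₀.right_inv hu] at this
      exact this
    · intro u hu
      obtain ⟨p, ⟨hps, hpW⟩, rfl⟩ := (hrsub hu).1
      refine ⟨c₀.map_source hps, ?_⟩
      rw [hso.interior_eq, mem_preimage, c₀.left_inv hps, hs_def]
      exact ⟨hpW, hps, hu⟩
  · intro p hp
    rw [OpenPartialHomeomorph.restr_apply]
    constructor
    · intro h0
      obtain ⟨y, hye, hyu, hys⟩ := hup (c₀ p) (hmem.1 hp).2.2 h0
      have : G.jB y = p :=
        c₀.injOn (hmem.1 hys).1 (hmem.1 hp).1 (by rw [hc₀j y hye, hyu])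
      exact ⟨y, this⟩
    · rintro ⟨y, rfl⟩
      rw [hc₀j y (hB hp)]
      exact (e y).2
  · intro p hp
    rw [OpenPartialHomeomorph.restr_apply]
    constructor
    · intro h0
      rcases G.mem_range_or p with hA | ⟨y, rfl⟩
      · exact hA
      · have hye := hB hp
        rw [hc₀j y hye] at h0
        have h1 : ‖(y : 𝔼 (n + 1))‖ = 1 :=
          (norm_eq_one_iff_of_mem_maximalAtlas he hye).2 (le_antisymm h0 (e y).2)
        obtain ⟨w, rfl⟩ := exists_sphereToBall_eq h1
        exact ⟨_, (G.jB_sphereToBall w).symm⟩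
    · rintro ⟨a, rfl⟩
      by_cases ha : ‖(a : 𝔼 (n + 1))‖ < 1
      · have hn : G.jA a ∉ range G.jB := G.jA_notMem_range_jB ha
        by_contra hlt
        rw [not_le] at hlt
        obtain ⟨y, -, hyu, hys⟩ := hup (c₀ (G.jA a)) (hmem.1 hp).2.2 hlt.le
        exact hn ⟨y, c₀.injOn (hmem.1 hys).1 (hmem.1 hp).1 (by rw [hc₀j y (hB hys), hyu])⟩
      · have ha1 : ‖(a : 𝔼 (n + 1))‖ = 1 := (mem_closedBall_zero_iff.1 a.2).antisymm (not_lt.1 ha)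
        obtain ⟨w, rfl⟩ := exists_sphereToBall_eq ha1
        rw [G.jA_sphereToBall] at hp ⊢
        have hye := hB hp
        rw [hc₀j _ hye, ((norm_eq_one_iff_of_mem_maximalAtlas he hye).1 (norm_sphereToBall _))]

/-- A choice of chart adapted to the seam at `z`. [folklore] -/
def seamChart [IsManifold (𝓡 (n + 1)) ∞ P] (G : BallGluingData n φ P) (z : 𝕊 n) : G.SeamChart z :=
  Classical.choice (G.nonempty_seamChart z)

namespace SeamChart

variable {G : BallGluingData n φ P} {z : 𝕊 n} (S : G.SeamChart z)

/-- The source of an adapted chart is open. [folklore] -/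
theorem isOpen_source : IsOpen S.chart.source := S.chart.open_source

/-- The centre lies in the target. [folklore] -/
theorem center_mem_target : S.center ∈ S.chart.target := by
  rw [S.target_eq]; exact mem_ball_self S.radius_pos

/-- An adapted chart maps its source into the target ball. [folklore] -/
theorem map_source {p : P} (hp : p ∈ S.chart.source) : S.chart p ∈ ball S.center S.radius := by
  rw [← S.target_eq]; exact S.chart.map_source hp

/-- The inverse of an adapted chart maps the target ball into the source. [folklore] -/
theorem symm_mem_source {u : 𝔼 (n + 1)} (hu : u ∈ ball S.center S.radius) :
    S.chart.symm u ∈ S.chart.source :=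
  S.chart.map_target (by rw [S.target_eq]; exact hu)

/-- `chart ∘ chart⁻¹ = id` on the target ball. [folklore] -/
theorem apply_symm {u : 𝔼 (n + 1)} (hu : u ∈ ball S.center S.radius) :
    S.chart (S.chart.symm u) = u :=
  S.chart.right_inv (by rw [S.target_eq]; exact hu)

/-- In an adapted chart the seam is the hyperplane `{u 0 = 0}`. [folklore] -/
theorem eq_zero_iff {p : P} (hp : p ∈ S.chart.source) :
    S.chart p 0 = 0 ↔ ∃ w : 𝕊 n, G.jA (sphereToBall n w) = p := by
  constructor
  · intro h0
    obtain ⟨b, hb⟩ := (S.nonneg_iff p hp).1 (le_of_eq h0.symm)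
    obtain ⟨a, rfl⟩ := (S.nonpos_iff p hp).1 h0.le
    obtain ⟨w, rfl⟩ := exists_sphereToBall_eq (G.norm_eq_one_left hb.symm)
    exact ⟨w, rfl⟩
  · rintro ⟨w, rfl⟩
    have h1 : S.chart (G.jA (sphereToBall n w)) 0 ≤ 0 := (S.nonpos_iff _ hp).2 ⟨_, rfl⟩
    have h2 : 0 ≤ S.chart (G.jA (sphereToBall n w)) 0 := by
      rw [G.jA_sphereToBall] at hp ⊢
      exact (S.nonneg_iff _ hp).2 ⟨_, rfl⟩
    exact le_antisymm h1 h2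

/-- In an adapted chart the open lower half ball is the interior of the first disc. [folklore] -/
theorem neg_iff {p : P} (hp : p ∈ S.chart.source) :
    S.chart p 0 < 0 ↔ ∃ a : 𝔻 (n + 1), ‖(a : 𝔼 (n + 1))‖ < 1 ∧ G.jA a = p := by
  constructor
  · intro h0
    have hB : p ∉ range G.jB := fun h => (not_le.2 h0) ((S.nonneg_iff p hp).2 h)
    exact G.exists_norm_lt_one_of_notMem_range_jB hB
  · rintro ⟨a, ha, rfl⟩
    exact lt_of_not_ge fun h => G.jA_notMem_range_jB ha ((S.nonneg_iff _ hp).1 h)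

/-- In an adapted chart the open upper half ball is the interior of the second disc. [folklore] -/
theorem pos_iff {p : P} (hp : p ∈ S.chart.source) :
    0 < S.chart p 0 ↔ ∃ b : 𝔻 (n + 1), ‖(b : 𝔼 (n + 1))‖ < 1 ∧ G.jB b = p := by
  constructor
  · intro h0
    have hA : p ∉ range G.jA := fun h => (not_le.2 h0) ((S.nonpos_iff p hp).2 h)
    exact G.exists_norm_lt_one_of_notMem_range_jA hA
  · rintro ⟨b, hb, rfl⟩
    exact lt_of_not_ge fun h => G.jB_notMem_range_jA hb ((S.nonpos_iff _ hp).1 h)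

/-- The norm of `jB⁻¹` read in an adapted chart: `‖jB⁻¹ p‖ < 1 ↔ 0 < chart p 0`. [folklore] -/
theorem norm_invB_lt_one_iff {p : P} (hp : p ∈ S.chart.source) (hpB : p ∈ range G.jB) :
    ‖(G.invB p : 𝔼 (n + 1))‖ < 1 ↔ 0 < S.chart p 0 := by
  rw [S.pos_iff hp]
  constructor
  · intro h
    exact ⟨G.invB p, h, G.jB_invB hpB⟩
  · rintro ⟨b, hb, rfl⟩
    rwa [G.invB_jB]

/-- The norm of `jA⁻¹` read in an adapted chart: `‖jA⁻¹ p‖ < 1 ↔ chart p 0 < 0`. [folklore] -/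
theorem norm_invA_lt_one_iff {p : P} (hp : p ∈ S.chart.source) (hpA : p ∈ range G.jA) :
    ‖(G.invA p : 𝔼 (n + 1))‖ < 1 ↔ S.chart p 0 < 0 := by
  rw [S.neg_iff hp]
  constructor
  · intro h
    exact ⟨G.invA p, h, G.jA_invA hpA⟩
  · rintro ⟨a, ha, rfl⟩
    rwa [G.invA_jA]

/-- Points of the upper half ball come from the second disc. [folklore] -/
theorem symm_mem_range_jB {u : 𝔼 (n + 1)} (hu : u ∈ ball S.center S.radius) (h0 : 0 ≤ u 0) :
    S.chart.symm u ∈ range G.jB :=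
  (S.nonneg_iff _ (S.symm_mem_source hu)).1 (by rwa [S.apply_symm hu])

/-- Points of the lower half ball come from the first disc. [folklore] -/
theorem symm_mem_range_jA {u : 𝔼 (n + 1)} (hu : u ∈ ball S.center S.radius) (h0 : u 0 ≤ 0) :
    S.chart.symm u ∈ range G.jA :=
  (S.nonpos_iff _ (S.symm_mem_source hu)).1 (by rwa [S.apply_symm hu])

/-- Points of the hyperplane come from the seam. [folklore] -/
theorem exists_eq_symm_of_eq_zero {u : 𝔼 (n + 1)} (hu : u ∈ ball S.center S.radius) (h0 : u 0 = 0) :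
    ∃ w : 𝕊 n, G.jA (sphereToBall n w) = S.chart.symm u :=
  (S.eq_zero_iff (S.symm_mem_source hu)).1 (by rwa [S.apply_symm hu])

/-- The image of the second disc in an adapted chart is the closed upper half ball. [folklore] -/
theorem image_range_jB :
    S.chart '' (range G.jB ∩ S.chart.source) = ball S.center S.radius ∩ {u | 0 ≤ u 0} := by
  ext u
  constructor
  · rintro ⟨p, ⟨hpB, hps⟩, rfl⟩
    exact ⟨S.map_source hps, (S.nonneg_iff p hps).2 hpB⟩
  · rintro ⟨hu, h0⟩
    exact ⟨S.chart.symm u, ⟨S.symm_mem_range_jB hu h0, S.symm_mem_source hu⟩, S.apply_symm hu⟩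

/-- The image of the first disc in an adapted chart is the closed lower half ball. [folklore] -/
theorem image_range_jA :
    S.chart '' (range G.jA ∩ S.chart.source) = ball S.center S.radius ∩ {u | u 0 ≤ 0} := by
  ext u
  constructor
  · rintro ⟨p, ⟨hpA, hps⟩, rfl⟩
    exact ⟨S.map_source hps, (S.nonpos_iff p hps).2 hpA⟩
  · rintro ⟨hu, h0⟩
    exact ⟨S.chart.symm u, ⟨S.symm_mem_range_jA hu h0, S.symm_mem_source hu⟩, S.apply_symm hu⟩

/-- **`jB⁻¹` read in an adapted chart is `C^∞` on the closed upper half ball** (one-sided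
derivatives along the hyperplane). [folklore] -/
theorem contDiffOn_invB [IsManifold (𝓡 (n + 1)) ∞ P] :
    ContDiffOn ℝ ∞ (fun u => ((G.invB (S.chart.symm u) : 𝔻 (n + 1)) : 𝔼 (n + 1)))
      (ball S.center S.radius ∩ {u | 0 ≤ u 0}) := by
  rw [← S.image_range_jB]
  exact contDiffOn_coe_ballEmbeddingInv_symm G.isSmoothEmbedding_jB S.mem_maximalAtlas

/-- **`jA⁻¹` read in an adapted chart is `C^∞` on the closed lower half ball.** [folklore] -/
theorem contDiffOn_invA [IsManifold (𝓡 (n + 1)) ∞ P] :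
    ContDiffOn ℝ ∞ (fun u => ((G.invA (S.chart.symm u) : 𝔻 (n + 1)) : 𝔼 (n + 1)))
      (ball S.center S.radius ∩ {u | u 0 ≤ 0}) := by
  rw [← S.image_range_jA]
  exact contDiffOn_coe_ballEmbeddingInv_symm G.isSmoothEmbedding_jA S.mem_maximalAtlas

/-- An adapted chart is `C^∞` on its source. [folklore] -/
theorem contMDiffOn_chart : ContMDiffOn (𝓡 (n + 1)) 𝓘(ℝ, 𝔼 (n + 1)) ∞ S.chart S.chart.source :=
  contMDiffOn_of_mem_maximalAtlas S.mem_maximalAtlas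

/-- An adapted chart is `C^∞` at each point of its source. [folklore] -/
theorem contMDiffAt_chart {p : P} (hp : p ∈ S.chart.source) :
    ContMDiffAt (𝓡 (n + 1)) 𝓘(ℝ, 𝔼 (n + 1)) ∞ S.chart p :=
  contMDiffAt_of_mem_maximalAtlas S.mem_maximalAtlas hp

/-- The inverse of an adapted chart is `C^∞` on the target ball. [folklore] -/
theorem contMDiffOn_symm :
    ContMDiffOn 𝓘(ℝ, 𝔼 (n + 1)) (𝓡 (n + 1)) ∞ S.chart.symm (ball S.center S.radius) := by
  rw [← S.target_eq]
  exact contMDiffOn_symm_of_mem_maximalAtlas S.mem_maximalAtlas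

/-- The inverse of an adapted chart is `C^∞` at each point of the target ball. [folklore] -/
theorem contMDiffAt_symm {u : 𝔼 (n + 1)} (hu : u ∈ ball S.center S.radius) :
    ContMDiffAt 𝓘(ℝ, 𝔼 (n + 1)) (𝓡 (n + 1)) ∞ S.chart.symm u :=
  S.contMDiffOn_symm.contMDiffAt (isOpen_ball.mem_nhds hu)

end SeamChart

end BallGluingData

end Seam

end Literature.Topology.FourManifolds
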